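import Summits.HodgeConjecture.HodgeConjecture.Theorems.F0P3cDbTEnvelopeTrichotomy          -- ★ `comap_cmDatumLocalCongr_symm_eq` (congruence independence, `N = 3`); brings D6 `MemXiFamily`, `IsXiLocalFamily`, `cmSplitPacket`, `splitWitness`, the (S-G) vocabulary
import Summits.HodgeConjecture.HodgeConjecture.Theorems.F0P3SqNSNonsplitConsumers             -- ★ K3♭ `eventually_not_isSupercuspidal_of_isSpherical_congr_of_nonsplit` (+ ★ compact centre at non-split `v`, ★ `forall_mem_center_cmLocal_eq_scalar`)
import Summits.HodgeConjecture.HodgeConjecture.Theorems.F0P3SqIntNotSphericalNonsplitCofinite  -- ★ (SqNS♭) `squareIntegrableNotSpherical_nonsplit_cofinite` (no `L²` class is `U(Φ₃)(𝒪_v)`-spherical, a.e. non-split `v`) — hypothesis-free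
import Summits.HodgeConjecture.HodgeConjecture.Theorems.F0P3N3ConeClosed                     -- ★ `keysCaseTwo_holds : ∀ L, KeysCaseTwo L` (exactly one `L²` constituent)
import Literature.NumberTheory.Rogawski1990.SemilocalQuadraticCharExtension                  -- ★ `isQuadraticCharExtension_semilocalComponent_of_baseChange_eq` (`μ|_{L⁺_v^×} = ω` from `hμω`)
import Literature.NumberTheory.Automorphic.LocalUnitaryIntegralLevelCongr                    -- ★ `eventually_exists_cmDatumLocalCongr_levelMatching_three` (level-matching frames, a.e.)
import Literature.NumberTheory.Rogawski1990.CharIdentityOnTestFunctionsSignedLemmas          -- (statement vocabulary of (AE-ⅰ): `hQS`'s type; = tree FILE B :3)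
import Literature.NumberTheory.Rogawski1990.FinExplicitTransferFactorConjLeft                -- (statement vocabulary: `finExplicitCollection`; = tree FILE B :4)
import Literature.NumberTheory.Rogawski1990.FinExplicitTransferFactorConjRight               -- (= tree FILE B :5)
import Literature.NumberTheory.Automorphic.OrbitalMeasureCanonical                           -- (= tree FILE B :6)
import Summits.HodgeConjecture.HodgeConjecture.Theorems.F0P3aArchDefinitePlace               -- (statement vocabulary: `ShimuraVarieties.hermForm`; = tree FILE B :7)
import Summits.HodgeConjecture.HodgeConjecture.Theorems.R90S9FlathOfAnisotropic             -- ★ `flath_of_anisotropic` (p861871): (FLATH) at every discrete `P` of `U(H)`, `H` anisotropic — UNCONDITIONAL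
import HarnessLib

/-!
# R90-TF · S9 «InnerForm-13.3.6 (c)» — (AE-ⅰ) «ENVELOPE ⟹ E.V.P.» FOR THE DEFINITE INNER FORM IS A THEOREM:
# the binder `hAE` of ★ `R90S9DefiniteXiMembershipCut.definiteXiMembership_of_ch14` (its type TOKEN FOR TOKEN) PROVED, no hypothesis left —
# (FLATH) holds at an anisotropic `H` (★ `flath_of_anisotropic`, compact quotient), and p04's ★ routing routine needs (FLATH) only AT THE GIVEN `P`

Cell `hodgecm-mathlib`, crux H413 (`stmt-HodgeConjecture-24833`, lane `--supports … --as helper`), route of record `HCCMUnconditional` (count-neutral).  Programme R90-TF,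
section S9 (base `R90-IF`); seat R90-IF-p05 (g0), deal «EMIT S9 WAVE 2» p05 → `sock_S9_definiteFlath` PAYER (R90-IF-plan (g0), R90 bus 2026-09-04T16:13:37Z); sequel to ★
`Theorems/R90S9FlathOfAnisotropic.lean` (p861871).  THEOREMS ONLY (no `def`, no instance, no notation, no named fact, no `sorry`); never imports a `Cruxes/…/Lines` module;
namespace `Summit.HodgeConjecture.HodgeConjecture.R90.S9`.
HONEST LABEL: HC_CM is proved only modulo the 7 printed citations (2 remaining named inputs: hLiu418 = stmt-HodgeConjecture-24832, h413 = stmt-HodgeConjecture-24833)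
— until rung 0 closes.  LOCAL ∕ admissibility bookkeeping only (no trace formula); ★ helper ≠ leaf.

## WHY THIS FILE (junction finding, R90 bus p05 REPORT #1)
★ `aeXiTrigger_of_flath` (p861581) and ★ `aeXiTrigger_of_memXiFamily_of_flath` (p861639) take the GLOBAL, UNGUARDED (FLATH) «for EVERY hermitian `H` with unit determinant,
every automorphic measure and every discrete `P`» as their one hypothesis — not payable today at an ISOTROPIC `H` (non-compact quotient; «irreducible unitary ⇒ admissible»
[Bernstein1974] is the Literature named fact «AFA») — although their proofs use it only at the given `(L, H, μA, P)`.  (B4) `SocketDefiniteXiMembership` lives on the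
ANISOTROPIC locus (guard `hanis`, [Rogawski1990, §14.5 p. 237]), where (FLATH) is ★ (`flath_of_anisotropic`).  So:
* §1 `aeXiTrigger_of_memXiFamily_of_flathAt` — p04's routine with the WEAKER, per-`P` hypothesis `hFlathP` «off a finite set every `v`-constituent of THIS `P` is
  `U(H)(𝒪_v)`-spherical» (general hermitian `H`; both ★ theorems above are its instances); conclusion = the (AE) clause TOKEN FOR TOKEN.
* §2 `definiteAeXiTrigger_holds` — **(AE-ⅰ) PROVED**: the type of the binder `hAE` of ★ `definiteXiMembership_of_ch14` ∕ the conclusion of ★ `aeXiTrigger_of_flath`, TOKEN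
  FOR TOKEN, with NO hypothesis: §1 fed by ★ `flath_of_anisotropic L H hanis μA P`.  Pay line for FILE B's (B4a) socket `SocketAeXiTrigger` (= `hAE` verbatim):
  `theorem sock_S9_aeXiTrigger : SocketAeXiTrigger := definiteAeXiTrigger_holds`; (B4)'s residual BY NAME is then {(AE-ⅱ) `sock_S9_definiteAeRigidity`} only:
  `definiteXiMembership_of_ch14 definiteAeXiTrigger_holds hRig : SocketDefiniteXiMembership`.
PROOF of §1 (= ★ p861639 verbatim but for the hypothesis): `S` := the finite union of the exceptional sets of `hFlathP`, of ★ (SqNS♭)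
`squareIntegrableNotSpherical_nonsplit_cofinite`, of ★ K3♭ `eventually_not_isSupercuspidal_of_isSpherical_congr_of_nonsplit` and of ★
`eventually_exists_cmDatumLocalCongr_levelMatching_three`; off `S`, at a non-split `v`, D6 gives the packet `⟨x ∘ e₀, s⟩` with `x ∈ {πn, π2}` (★ `KeysCaseTwoLabels`) and `s`
supercuspidal; `c = s` is spherical-and-supercuspidal (absurd, K3♭); `c = π2 ∘ e₀` would be a spherical `L²` class (Keys' case (2) has exactly one `L²` constituent, ★
`keysCaseTwo_holds`; transport along the level-matching frame ★ `IrrClass.isSpherical_comap_iff_of_forall_mem_iff`), contradicting (SqNS♭); so `c = πn ∘ e₀ = πn ∘ e` for any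
frame (★ `comap_cmDatumLocalCongr_symm_eq`).  At a split `v` the packet IS the ★ `cmSplitPacket` and `c` is a member.
[cite: Rogawski1990, §14.6 p. 242; §14.5 p. 237; §12.2 (2) pp. 173–174; §13.1 Prop. 13.1.3 (d) p. 199; §14.2 pp. 232–233; §4.13 Lemma 4.13.1 (b) p. 64]
[cite: FlathCorvallis1979, Thm. 3] [cite: Godement1964, Exp. 257 Thm. 4.2] [cite: HarishChandra1970, Part I §3, p. 9] [cite: Macdonald1971, Ch. V]
-/

set_option autoImplicit false
-- the mandated namespace repeats `HodgeConjecture.HodgeConjecture`, as in every `Theorems/*.lean` of this sub-problem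
set_option linter.dupNamespace false

noncomputable section

open NumberField IsDedekindDomain MeasureTheory Filter
open scoped Matrix ComplexOrder

open Literature.NumberTheory Literature.NumberTheory.Automorphic Literature.NumberTheory.Automorphic.UnitaryGroup
open Literature.NumberTheory.Automorphic.IdeleClassGroup
open Literature.NumberTheory.GaloisRepresentations
open Literature.NumberTheory.Rogawski1990
open Summit.HodgeConjecture.HodgeConjecture.Cruxes.H413

namespace Summit.HodgeConjecture.HodgeConjecture.R90.S9

/-! ## §1 The routing routine with the per-`P` (FLATH) hypothesis -/

open scoped Classical in
set_option synthInstance.maxHeartbeats 400000 in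
set_option maxHeartbeats 8000000 in
/-- **(FLATH AT `P`) ⟹ (AE) «ENVELOPE ⟹ E.V.P.» at a general hermitian `H`** — for a discrete `P` of `U(H)` in the ξ-envelope (★ `MemXiFamily`) whose `v`-constituents
are `U(H)(𝒪_v)`-spherical off a finite set (`hFlathP`, the per-`P` (FLATH); ★ at anisotropic `H` by `flath_of_anisotropic`, and for `P` with an irreducible admissible finite
component by ★ `flath_of_hasFinComponent`), off a finite set of finite places every `v`-constituent IS `πⁿ(ξ_v) ∘ e` (non-split `v`) ∕ lies in the ★ `cmSplitPacket` of `ξ`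
(split `v`).  ★ p861639 `aeXiTrigger_of_memXiFamily_of_flath` with its global hypothesis weakened to the one instance the proof uses; (SqNS♭), K3♭, Keys' case (2), congruence
independence and level matching are ★.  No sorry; axioms TRIO.
[cite: Rogawski1990, §14.6 p. 242; §12.2 (2) pp. 173–174; §13.1 Prop. 13.1.3 (d) p. 199; §14.2 pp. 232–233; §4.13 Lemma 4.13.1 (b) p. 64] [cite: FlathCorvallis1979, Thm. 3] -/
theorem aeXiTrigger_of_memXiFamily_of_flathAt
    (L : Type) [Field L] [NumberField L] [IsCMField L] (H : Matrix (Fin 3) (Fin 3) L)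
    (hH : (H.map (cmConjRingHom L))ᵀ = H) (hHd : IsUnit H.det) (μω : HeckeCharacter L) (hμu : μω.IsUnitary)
    (hμω : ∀ x : Literature.NumberTheory.GaloisRepresentations.ideleGroup ↥(maximalRealSubfield L),
      μω (AdeleRing.ideleBaseChange (↥(maximalRealSubfield L)) L x) = quadraticHeckeCharCM L x)
    (ξ : OneDimAutRepH L)
    (μA : Measure (adelicGroupData (↥(maximalRealSubfield L)) L (IsCMField.complexConj L) 3 H).automorphicQuotient)
    [(adelicGroupData (↥(maximalRealSubfield L)) L (IsCMField.complexConj L) 3 H).IsAutomorphicMeasure μA]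
    (P : DiscreteAutomorphicRep (adelicGroupData (↥(maximalRealSubfield L)) L (IsCMField.complexConj L) 3 H) μA)
    (hFlathP : ∀ᶠ v : HeightOneSpectrum (𝓞 ↥(maximalRealSubfield L)) in cofinite,
      ∀ c : IrrClass ((cmDatum L 3 H).Local v),
        (IrrClass.comap (localPiEquiv L (IsCMField.complexConj L) 3 H v) c).IsConstituentOf
            (P.finRep.smoothPart.toRepresentation.comp (inclPlace (↥(maximalRealSubfield L)) L (IsCMField.complexConj L) 3 H v)) →
        c.IsSpherical (cmLocalIntegralLevel L 3 H v))
    (hmem : MemXiFamily P hH hHd μω hμu ξ) :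
        -- (AE) «t(P) = t(Π(ξ))»: off a finite set of finite places, P_v IS πⁿ(ξ_v) ∘ e (non-split v) ∕ the split member i_G(ξ_v ⊗ μ_w ∘ det₀) (split v)
        (∃ S : Finset (HeightOneSpectrum (𝓞 ↥(maximalRealSubfield L))),
          (∀ v : HeightOneSpectrum (𝓞 ↥(maximalRealSubfield L)), v ∉ S →
            ∀ (hns : ∀ w : PlacesOver L v, IsCMField.complexConj L • w.1 = w.1)
              (T : GL (Fin 3) (LocalRing L v)) (a : LocalRing L v) (ha : IsUnit a)
              (h : formCongr (conjLocal L (IsCMField.complexConj L) v) T (H.map (algebraMap L (LocalRing L v))) =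
                a • (Matrix.of fun i j : Fin 3 => if i.val + j.val + 1 = 3 then (1 : L) else 0).map (algebraMap L (LocalRing L v))),
            ∀ [MeasurableSpace (Gqs L v ⧸ Subgroup.center (Gqs L v))] [BorelSpace (Gqs L v ⧸ Subgroup.center (Gqs L v))]
              (μZ : Measure (Gqs L v ⧸ Subgroup.center (Gqs L v))) [μZ.IsHaarMeasure],
            ∀ (π2 πn : IrrClass (Gqs L v)),
              KeysCaseTwoLabels L v (μω.semilocalComponent L v) (torusLocalComponent L (IsCMField.complexConj L) v ξ.η)
                (torusLocalComponent L (IsCMField.complexConj L) v ξ.ψ) π2 πn →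
              ¬ πn.IsSquareIntegrable μZ →
              ∀ c : IrrClass ((cmDatum L 3 H).Local v),
                (IrrClass.comap (localPiEquiv L (IsCMField.complexConj L) 3 H v) c).IsConstituentOf
                    (P.finRep.smoothPart.toRepresentation.comp (inclPlace (↥(maximalRealSubfield L)) L (IsCMField.complexConj L) 3 H v)) →
                c = IrrClass.comap (cmDatumLocalCongr L v T ha h).symm πn) ∧
          (∀ v : HeightOneSpectrum (𝓞 ↥(maximalRealSubfield L)), v ∉ S →
            ∀ (hs : ∃ w : PlacesOver L v, IsCMField.complexConj L • w.1 ≠ w.1),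
              ∀ c : IrrClass ((cmDatum L 3 H).Local v),
                (IrrClass.comap (localPiEquiv L (IsCMField.complexConj L) 3 H v) c).IsConstituentOf
                    (P.finRep.smoothPart.toRepresentation.comp (inclPlace (↥(maximalRealSubfield L)) L (IsCMField.complexConj L) 3 H v)) →
                c ∈ (cmSplitPacket L H hH hHd v (splitWitness v hs) (splitWitness_spec v hs) (ξ.splitν₀ μω (splitWitness v hs).1)
                  (ξ.locψ (splitWitness v hs).1) (ξ.norm_splitν₀_apply hμu (splitWitness v hs).1)
                  (ξ.continuous_splitν₀ μω (splitWitness v hs).1) (ξ.norm_locψ_apply (splitWitness v hs).1)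
                  (ξ.continuous_locψ (splitWitness v hs).1)).members)) := by
  obtain ⟨Pv, hfam, hloc⟩ := hmem
  -- the four cofinite supplies: (FLATH) at `P`, ★ (SqNS♭), ★ K3♭, ★ level-matching frames
  have hSq := F0P3SqIntNotSphericalNonsplitCofinite.squareIntegrableNotSpherical_nonsplit_cofinite L
  have hK3 := F0P3SqNSNonsplitConsumers.eventually_not_isSupercuspidal_of_isSpherical_congr_of_nonsplit L H hSq
  have hlev := eventually_exists_cmDatumLocalCongr_levelMatching_three L H hH hHd
  have hfin := Filter.eventually_cofinite.1 (hFlathP.and (hSq.and (hK3.and hlev)))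
  refine ⟨hfin.toFinset, fun v hv hns T a ha h _ _ μZ _ π2 πn hK hn c hc => ?_, fun v _ hs c hc => ?_⟩
  · -- NON-SPLIT `v ∉ S`
    have hv' : (∀ c : IrrClass ((cmDatum L 3 H).Local v),
        (IrrClass.comap (localPiEquiv L (IsCMField.complexConj L) 3 H v) c).IsConstituentOf
            (P.finRep.smoothPart.toRepresentation.comp (inclPlace (↥(maximalRealSubfield L)) L (IsCMField.complexConj L) 3 H v)) →
          c.IsSpherical (cmLocalIntegralLevel L 3 H v)) ∧
        ((∀ w : PlacesOver L v, IsCMField.complexConj L • w.1 = w.1) →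
          ∀ [MeasurableSpace (Gqs L v ⧸ Subgroup.center (Gqs L v))] [BorelSpace (Gqs L v ⧸ Subgroup.center (Gqs L v))]
            (μZ : Measure (Gqs L v ⧸ Subgroup.center (Gqs L v))) [μZ.IsHaarMeasure] (c : IrrClass (Gqs L v)),
            c.IsSquareIntegrable μZ → ¬ c.IsSpherical (cmLocalIntegralLevel L 3 (qsForm L) v)) ∧
        ((∀ w : PlacesOver L v, IsCMField.complexConj L • w.1 = w.1) →
          IsCompact ((Subgroup.center (Gqs L v) : Subgroup (Gqs L v)) : Set (Gqs L v)) →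
          ∀ [MeasurableSpace (Gqs L v ⧸ Subgroup.center (Gqs L v))] [BorelSpace (Gqs L v ⧸ Subgroup.center (Gqs L v))]
            (μZ : Measure (Gqs L v ⧸ Subgroup.center (Gqs L v))) [μZ.IsHaarMeasure]
            (e : (cmDatum L 3 H).Local v ≃ₜ* Gqs L v),
            (∀ g : (cmDatum L 3 H).Local v, e g ∈ cmLocalIntegralLevel L 3 (qsForm L) v ↔ g ∈ cmLocalIntegralLevel L 3 H v) →
            ∀ c : IrrClass ((cmDatum L 3 H).Local v), c.IsSpherical (cmLocalIntegralLevel L 3 H v) → ¬ c.IsSupercuspidal) ∧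
        ((∀ w : PlacesOver L v, IsCMField.complexConj L • w.1 = w.1) →
          ∃ (T : GL (Fin 3) (LocalRing L v)) (a : LocalRing L v) (ha : IsUnit a)
            (h : formCongr (conjLocal L (IsCMField.complexConj L) v) T (H.map (algebraMap L (LocalRing L v))) =
              a • (Rogawski1990.qsForm L).map (algebraMap L (LocalRing L v))),
            ∀ g : (cmDatum L 3 H).Local v,
              (cmDatumLocalCongr L v T ha h).symm g ∈ cmLocalIntegralLevel L 3 (Rogawski1990.qsForm L) v ↔
                g ∈ cmLocalIntegralLevel L 3 H v) := by
      by_contra hc'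
      exact hv (hfin.mem_toFinset.2 hc')
    obtain ⟨hsphv, hSqv, hK3v, hlevv⟩ := hv'
    have hcsph : c.IsSpherical (cmLocalIntegralLevel L 3 H v) := hsphv c hc
    obtain ⟨T₁, a₁, ha₁, h₁, hlev₁⟩ := hlevv hns
    -- D6 at the non-split `v`: the family's packet is `⟨x ∘ e₀, s⟩`
    obtain ⟨T₀, a₀, ha₀, h₀, x, s, hPv, hx, hs⟩ := hfam.2 v hns
    have hcm : c ∈ (Pv v).members := hloc v c hc
    rw [hPv, LocalAPacket.mem_members_iff] at hcm
    rcases hcm with hcx | hcs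
    · -- `c = x ∘ e₀`, `x ∈ {πn, π2}`
      have hcx' : c = IrrClass.comap (cmDatumLocalCongr L v T₀ ha₀ h₀).symm x := hcx
      rcases (hK.2 x).1 hx with hxn | hx2
      · rw [hcx', hxn]
        exact F0P3cDbTEnvelopeTrichotomy.comap_cmDatumLocalCongr_symm_eq L H hH T₀ T ha₀ ha h₀ h πn
      · exfalso
        -- `π2` IS square-integrable: Keys' case (2) has exactly one `L²` constituent and `πn` is not it
        obtain ⟨πs₀, πn₀, _hne₀, hJH₀, hs₀, hn₀⟩ :=
          (F0P3N3ConeClosed.keysCaseTwo_holds L).exists_labels v hns (μω.semilocalComponent L v)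
            (torusLocalComponent L (IsCMField.complexConj L) v ξ.η) (torusLocalComponent L (IsCMField.complexConj L) v ξ.ψ)
            (isQuadraticCharExtension_semilocalComponent_of_baseChange_eq μω hμω v)
            (Units.continuous_val.comp (continuous_semilocalComponent (v := v) L μω))
            (continuous_torusLocalComponent (v := v) L (IsCMField.complexConj L) ξ.η)
            (continuous_torusLocalComponent (v := v) L (IsCMField.complexConj L) ξ.ψ) μZ
        have hπn : πn = πn₀ ∨ πn = πs₀ := (hJH₀ πn).1 ((hK.2 πn).2 (Or.inl rfl))
        have hπ2 : π2 = πn₀ ∨ π2 = πs₀ := (hJH₀ π2).1 ((hK.2 π2).2 (Or.inr rfl))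
        have hπ2L2 : π2.IsSquareIntegrable μZ := by
          rcases hπ2 with h2 | h2
          · rcases hπn with hn' | hn'
            · exact absurd (h2.trans hn'.symm) hK.1
            · exact absurd (hn' ▸ hs₀) hn
          · exact h2 ▸ hs₀
        -- `c = π2 ∘ e₀ = π2 ∘ e₁` is `U(H)(𝒪_v)`-spherical; transport along the level-matching `e₁` and contradict (SqNS♭)
        have hsph₁ : (IrrClass.comap (cmDatumLocalCongr L v T₁ ha₁ h₁).symm π2).IsSpherical (cmLocalIntegralLevel L 3 H v) := by
          rw [← F0P3cDbTEnvelopeTrichotomy.comap_cmDatumLocalCongr_symm_eq L H hH T₀ T₁ ha₀ ha₁ h₀ h₁ π2, ← hx2, ← hcx']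
          exact hcsph
        exact hSqv hns μZ π2 hπ2L2
          ((IrrClass.isSpherical_comap_iff_of_forall_mem_iff (cmDatumLocalCongr L v T₁ ha₁ h₁).symm π2 hlev₁).1 hsph₁)
    · -- `c = s` supercuspidal AND spherical: absurd by K3♭ (compact centre at the non-split `v`, level-matching `e₁`)
      have hZ : IsCompact ((Subgroup.center (Gqs L v) : Subgroup (Gqs L v)) : Set (Gqs L v)) :=
        (F0P3bLocalNonsplitCompactCenter.local_nonsplit_compactOpen_center_of_center_le L 3 (qsForm L) (isUnit_antidiagOne_det L 3) v hns
          (forall_mem_center_cmLocal_eq_scalar L (qsForm L) (antidiagOne_isHermitian L 3) (isUnit_antidiagOne_det L 3) v hns)).2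
      exact (hK3v hns hZ μZ (cmDatumLocalCongr L v T₁ ha₁ h₁).symm hlev₁ c hcsph (hs c hcs)).elim
  · -- SPLIT `v`: the family's packet IS the D6 split packet at the fixed witness (every split `v`, not only `v ∉ S`)
    have hcm : c ∈ (Pv v).members := hloc v c hc
    rw [hfam.1 v hs] at hcm
    exact hcm

/-! ## §2 (AE-ⅰ) for the definite inner form — PROVED -/

open scoped Classical in
set_option synthInstance.maxHeartbeats 400000 in
set_option maxHeartbeats 8000000 in
/-- **(AE-ⅰ) «ENVELOPE ⟹ E.V.P.» FOR THE DEFINITE INNER FORM — A THEOREM, NO HYPOTHESIS.**  The type of the binder `hAE` of ★ `definiteXiMembershipCut.definiteXiMembership_of_ch14`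
(= the conclusion of ★ `aeXiTrigger_of_flath`, = FILE B's (B4a) `SocketAeXiTrigger` body) TOKEN FOR TOKEN: for every CM `L`, hermitian `H ∈ M₃(L)` with unit determinant which is
ANISOTROPIC (`hanis`; the second guard `hS₀` and the packet data `Δ, mH, mG, νG, νH, hQS, …` are carried, unused), every `ξ`, automorphic measure and discrete `P` with
`MemXiFamily P … ξ`: off a finite set of finite places every `v`-constituent of `P` is `πⁿ(ξ_v) ∘ e` (non-split `v`) ∕ in the ★ `cmSplitPacket` (split `v`).  Proof: §1 at the
per-`P` (FLATH) ★ `flath_of_anisotropic L H hanis μA P` (Godement compactness of `[U(H)]` + in-house «AFA» on the compact quotient + Flath's count).  No sorry; axioms TRIO.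
[cite: Rogawski1990, §14.6 p. 242; §14.5 p. 237; §12.2 (2) pp. 173–174] [cite: FlathCorvallis1979, Thm. 3] [cite: Godement1964, Exp. 257 Thm. 4.2] -/
theorem definiteAeXiTrigger_holds :
    ∀ (L : Type) [Field L] [NumberField L] [IsCMField L] (H : Matrix (Fin 3) (Fin 3) L)
      (hH : (H.map (cmConjRingHom L))ᵀ = H) (hHd : IsUnit H.det),
      (∀ x : Fin 3 → L, Literature.AlgebraicGeometry.ShimuraVarieties.hermForm (cmConjRingHom L) H x x = 0 → x = 0) →
        (∃ τ : L →+* ℂ, (H.map τ).PosDef ∨ (-(H.map τ)).PosDef) →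
    ∀ [∀ v : HeightOneSpectrum (𝓞 ↥(maximalRealSubfield L)), MeasurableSpace ((cmDatum L 3 H).Local v)]
      [∀ v : HeightOneSpectrum (𝓞 ↥(maximalRealSubfield L)),
        MeasurableSpace ((cmDatum L 2 (Matrix.of fun i j : Fin 2 => if i.val + j.val + 1 = 2 then (1 : L) else 0)).Local v ×
          (cmDatum L 1 (Matrix.of fun i j : Fin 1 => if i.val + j.val + 1 = 1 then (1 : L) else 0)).Local v)]
      [∀ (v : HeightOneSpectrum (𝓞 ↥(maximalRealSubfield L)))
          (a : ((cmDatum L 2 (Matrix.of fun i j : Fin 2 => if i.val + j.val + 1 = 2 then (1 : L) else 0)).Local v ×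
            (cmDatum L 1 (Matrix.of fun i j : Fin 1 => if i.val + j.val + 1 = 1 then (1 : L) else 0)).Local v)),
        MeasurableSpace (((cmDatum L 2 (Matrix.of fun i j : Fin 2 => if i.val + j.val + 1 = 2 then (1 : L) else 0)).Local v ×
            (cmDatum L 1 (Matrix.of fun i j : Fin 1 => if i.val + j.val + 1 = 1 then (1 : L) else 0)).Local v) ⧸
          Subgroup.centralizer ({a} : Set ((cmDatum L 2 (Matrix.of fun i j : Fin 2 => if i.val + j.val + 1 = 2 then (1 : L) else 0)).Local v ×
            (cmDatum L 1 (Matrix.of fun i j : Fin 1 => if i.val + j.val + 1 = 1 then (1 : L) else 0)).Local v)))]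
      [∀ (v : HeightOneSpectrum (𝓞 ↥(maximalRealSubfield L))) (γ : (cmDatum L 3 H).Local v),
        MeasurableSpace ((cmDatum L 3 H).Local v ⧸ Subgroup.centralizer ({γ} : Set ((cmDatum L 3 H).Local v)))]
      (Δ : ∀ v : HeightOneSpectrum (𝓞 ↥(maximalRealSubfield L)), LocalTransferFactor L H v)
      (mH : ∀ v : HeightOneSpectrum (𝓞 ↥(maximalRealSubfield L)),
        OrbitalMeasureFamily ((cmDatum L 2 (Matrix.of fun i j : Fin 2 => if i.val + j.val + 1 = 2 then (1 : L) else 0)).Local v ×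
          (cmDatum L 1 (Matrix.of fun i j : Fin 1 => if i.val + j.val + 1 = 1 then (1 : L) else 0)).Local v))
      (mG : ∀ v : HeightOneSpectrum (𝓞 ↥(maximalRealSubfield L)), OrbitalMeasureFamily ((cmDatum L 3 H).Local v))
      (νG : ∀ v : HeightOneSpectrum (𝓞 ↥(maximalRealSubfield L)), Measure ((cmDatum L 3 H).Local v))
      (νH : ∀ v : HeightOneSpectrum (𝓞 ↥(maximalRealSubfield L)),
        Measure ((cmDatum L 2 (Matrix.of fun i j : Fin 2 => if i.val + j.val + 1 = 2 then (1 : L) else 0)).Local v ×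
          (cmDatum L 1 (Matrix.of fun i j : Fin 1 => if i.val + j.val + 1 = 1 then (1 : L) else 0)).Local v))
      [∀ v : HeightOneSpectrum (𝓞 ↥(maximalRealSubfield L)), BorelSpace ((cmDatum L 3 H).Local v)]
      [∀ v : HeightOneSpectrum (𝓞 ↥(maximalRealSubfield L)),
        BorelSpace ((cmDatum L 2 (Matrix.of fun i j : Fin 2 => if i.val + j.val + 1 = 2 then (1 : L) else 0)).Local v ×
          (cmDatum L 1 (Matrix.of fun i j : Fin 1 => if i.val + j.val + 1 = 1 then (1 : L) else 0)).Local v)]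
      [∀ (v : HeightOneSpectrum (𝓞 ↥(maximalRealSubfield L)))
          (a : ((cmDatum L 2 (Matrix.of fun i j : Fin 2 => if i.val + j.val + 1 = 2 then (1 : L) else 0)).Local v ×
            (cmDatum L 1 (Matrix.of fun i j : Fin 1 => if i.val + j.val + 1 = 1 then (1 : L) else 0)).Local v)),
        BorelSpace (((cmDatum L 2 (Matrix.of fun i j : Fin 2 => if i.val + j.val + 1 = 2 then (1 : L) else 0)).Local v ×
            (cmDatum L 1 (Matrix.of fun i j : Fin 1 => if i.val + j.val + 1 = 1 then (1 : L) else 0)).Local v) ⧸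
          Subgroup.centralizer ({a} : Set ((cmDatum L 2 (Matrix.of fun i j : Fin 2 => if i.val + j.val + 1 = 2 then (1 : L) else 0)).Local v ×
            (cmDatum L 1 (Matrix.of fun i j : Fin 1 => if i.val + j.val + 1 = 1 then (1 : L) else 0)).Local v)))]
      [∀ (v : HeightOneSpectrum (𝓞 ↥(maximalRealSubfield L))) (γ : (cmDatum L 3 H).Local v),
        BorelSpace ((cmDatum L 3 H).Local v ⧸ Subgroup.centralizer ({γ} : Set ((cmDatum L 3 H).Local v)))]
      [∀ v, (νG v).IsHaarMeasure] [∀ v, (νG v).IsMulRightInvariant] [∀ v, (νH v).IsHaarMeasure] [∀ v, (νH v).IsMulRightInvariant],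
      ∀ (μω : HeckeCharacter L) (hμu : μω.IsUnitary),
      (∀ x : Literature.NumberTheory.GaloisRepresentations.ideleGroup ↥(maximalRealSubfield L),
        μω (AdeleRing.ideleBaseChange (↥(maximalRealSubfield L)) L x) = quadraticHeckeCharCM L x) →
      Δ = finExplicitCollection L H μω (finExplicitDelta_conj_left_all L H μω) (finExplicitDelta_conj_right_all L H μω) →
      (∀ v : HeightOneSpectrum (𝓞 ↥(maximalRealSubfield L)), (mH v).IsCanonical (IsLocalGRegular L v) (νH v) ∧
        (mG v).IsCanonical (fun γ => IsRegularElt (γ.val : GL (Fin 3) (UnitaryGroup.LocalRing L v))) (νG v)) →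
      ∀ (hQS : CMCharIdentityPackageTestSigned L H hH hHd νH νG μω hμu Δ mH mG),
      (∀ v : HeightOneSpectrum (𝓞 ↥(maximalRealSubfield L)), (∀ w : PlacesOver L v, IsCMField.complexConj L • w.1 = w.1) →
        IsLocalDeltaTransferExists L H v (Δ v) (mH v) (mG v) Literature.NumberTheory.Rogawski1990.IsLocSmooth
          Literature.NumberTheory.Rogawski1990.IsLocSmooth) →
      ∀ (ξ : OneDimAutRepH L)
        (μA : Measure (adelicGroupData (↥(maximalRealSubfield L)) L (IsCMField.complexConj L) 3 H).automorphicQuotient)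
        [(adelicGroupData (↥(maximalRealSubfield L)) L (IsCMField.complexConj L) 3 H).IsAutomorphicMeasure μA]
        (P : DiscreteAutomorphicRep (adelicGroupData (↥(maximalRealSubfield L)) L (IsCMField.complexConj L) 3 H) μA),
        MemXiFamily P hH hHd μω hμu ξ →
        -- (AE) «t(P) = t(Π(ξ))»: off a finite set of finite places, P_v IS πⁿ(ξ_v) ∘ e (non-split v) ∕ the split member i_G(ξ_v ⊗ μ_w ∘ det₀) (split v)
        (∃ S : Finset (HeightOneSpectrum (𝓞 ↥(maximalRealSubfield L))),
          (∀ v : HeightOneSpectrum (𝓞 ↥(maximalRealSubfield L)), v ∉ S →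
            ∀ (hns : ∀ w : PlacesOver L v, IsCMField.complexConj L • w.1 = w.1)
              (T : GL (Fin 3) (LocalRing L v)) (a : LocalRing L v) (ha : IsUnit a)
              (h : formCongr (conjLocal L (IsCMField.complexConj L) v) T (H.map (algebraMap L (LocalRing L v))) =
                a • (Matrix.of fun i j : Fin 3 => if i.val + j.val + 1 = 3 then (1 : L) else 0).map (algebraMap L (LocalRing L v))),
            ∀ [MeasurableSpace (Gqs L v ⧸ Subgroup.center (Gqs L v))] [BorelSpace (Gqs L v ⧸ Subgroup.center (Gqs L v))]
              (μZ : Measure (Gqs L v ⧸ Subgroup.center (Gqs L v))) [μZ.IsHaarMeasure],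
            ∀ (π2 πn : IrrClass (Gqs L v)),
              KeysCaseTwoLabels L v (μω.semilocalComponent L v) (torusLocalComponent L (IsCMField.complexConj L) v ξ.η)
                (torusLocalComponent L (IsCMField.complexConj L) v ξ.ψ) π2 πn →
              ¬ πn.IsSquareIntegrable μZ →
              ∀ c : IrrClass ((cmDatum L 3 H).Local v),
                (IrrClass.comap (localPiEquiv L (IsCMField.complexConj L) 3 H v) c).IsConstituentOf
                    (P.finRep.smoothPart.toRepresentation.comp (inclPlace (↥(maximalRealSubfield L)) L (IsCMField.complexConj L) 3 H v)) →
                c = IrrClass.comap (cmDatumLocalCongr L v T ha h).symm πn) ∧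
          (∀ v : HeightOneSpectrum (𝓞 ↥(maximalRealSubfield L)), v ∉ S →
            ∀ (hs : ∃ w : PlacesOver L v, IsCMField.complexConj L • w.1 ≠ w.1),
              ∀ c : IrrClass ((cmDatum L 3 H).Local v),
                (IrrClass.comap (localPiEquiv L (IsCMField.complexConj L) 3 H v) c).IsConstituentOf
                    (P.finRep.smoothPart.toRepresentation.comp (inclPlace (↥(maximalRealSubfield L)) L (IsCMField.complexConj L) 3 H v)) →
                c ∈ (cmSplitPacket L H hH hHd v (splitWitness v hs) (splitWitness_spec v hs) (ξ.splitν₀ μω (splitWitness v hs).1)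
                  (ξ.locψ (splitWitness v hs).1) (ξ.norm_splitν₀_apply hμu (splitWitness v hs).1)
                  (ξ.continuous_splitν₀ μω (splitWitness v hs).1) (ξ.norm_locψ_apply (splitWitness v hs).1)
                  (ξ.continuous_locψ (splitWitness v hs).1)).members)) := by
  intro L _ _ _ H hH hHd hanis _hS₀ _ _ _ _ _Δ _mH _mG _νG _νH _ _ _ _ _ _ _ _ μω hμu hμω _hΔ _hcan _hQS _hex ξ μA _ P hmem
  exact aeXiTrigger_of_memXiFamily_of_flathAt L H hH hHd μω hμu hμω ξ μA P (flath_of_anisotropic L H hanis μA P) hmem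

end Summit.HodgeConjecture.HodgeConjecture.R90.S9

end
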